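import Literature.AnabelianGeometry.AbsoluteAnabelian.AbsTopII.TwoTripodNodalIndexInertia
import Literature.IUT.HodgeTheaters.ZHatEndomorphisms
import HarnessLib

/-!
# [AbsTopII] Prop 1.3 (x) at the index-`i` two-vertex datum, I: graph sections over `closure ⟨t₀^i⟩ ≅ Ẑ^Σ`

S. Mochizuki, *Topics in Absolute Anabelian Geometry II* [AbsTopII] (bib `MochizukiAbsTopII2013`; locators =
PDF pages of the kurims manuscript `paper:url-585b8d0ad0d9`), §1 Prop 1.3 (x) p. 12 ("Let `τ_I : I → Π_I` be the
[outer] homomorphism that arises [by functoriality!] from a 'log point' `τ_S ∈ X^{log}(S^{log})`") and Prop 1.3 (iii)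
p. 11 ("`I_v ≅ Ẑ^Σ`"); [SemiAnbd] (`MochizukiSemiAnbd2006`) Ex. 2.10 p. 31 (pro-`Σ` completions).

PROOF-ONLY support file (abc-iut-f-066 gen 8, row «TWO-VERTEX-Σ-INDEX-i») for the log-point family of the index-`i`
datum `M.dpscIdx` (`AbsTopII/TwoTripodNodalIndexLogPoints.lean`): the sections of `Π_I^{(i)} ↠ I ≅ Ẑ^Σ` are GRAPHS
of continuous homomorphisms out of the free pro-`Σ`-cyclic inertia section `B = closure ⟨b⟩` (`b = t₀^i` or `u₀^i`),
and the generic calculus proved here supplies their defining properties: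

* `IsFreeProSigmaCyclic.isProSigmaCompletion_zpowersHom` — **a free pro-`Σ`-cyclic compact group with dense `⟨g⟩` is
  the pro-`Σ` completion of `ℤ` along `m ↦ g^m`** (the universal property needed to build graph homomorphisms out of
  `closure ⟨t₀^i⟩`, which — unlike `T` — is not the completed section of the model);
* `exists_graphHom` — for `B = closure ⟨b⟩ ≅ Ẑ^Σ` closed in `P` and `y` in a closed `K ⊆ Π_𝔾`, a continuous `θ : B → P`
  with values in `K` and `θ(b) = y`;
* `graphSection_inf_PiG` — **`closure ⟨y·b⟩ ∩ Π_𝔾 = 1`** when `K` commutes with `B` and `B ∩ Π_𝔾 = 1` (the section lies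
  in the graph `{θ(s)·s}`); `graphSection_le`, `graphSection_sup_PiG` — **`closure ⟨y·b⟩ · Π_𝔾 = Π_𝔾 · B`**.
HONEST FRAMING: classical profinite group theory at a constructed model (constructed ≠ geometric); nothing here bears
on [IUTchIII] Cor 3.12; no side taken.
-/

noncomputable section

open scoped Pointwise

namespace Literature.AnabelianGeometry.AbsoluteAnabelian.AbsTopII

open Literature.AnabelianGeometry.SemiGraphs
open Literature.AnabelianGeometry.SemiGraphs.SemiGraphOfAnabelioids (IsProSigmaCompletion)
open Literature.AnabelianGeometry.SemiGraphs.SemiGraphOfAnabelioids.IsProSigmaCompletion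
open Literature.AnabelianGeometry.Anabelioids (IsSigmaInteger)
open _root_.Topology

/-! ### A free pro-`Σ`-cyclic group is the pro-`Σ` completion of `ℤ` along a dense generator -/

/-- **A free pro-`Σ`-cyclic compact Hausdorff group `G` with dense `⟨g⟩` is the pro-`Σ` completion of `ℤ` along
`m ↦ g^m`**: dense image; open normal subgroups of `Σ`-integer index; and the subgroup `nℤ` of `Σ`-integer index `n`
is the pull-back of the open subgroup `closure ⟨gⁿ⟩` of index `n` (subgroups of `ℤ` by index: abc-iut-w5-d145's
`ZHat.ofAdd_mem_iff_index_dvd`). [cite: MochizukiSemiAnbd2006, Ex. 2.10 p.31]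
[cite: MochizukiAbsTopII2013, Prop 1.3 (i) p.11] -/
theorem IsFreeProSigmaCyclic.isProSigmaCompletion_zpowersHom {S : Set ℕ} {G : Type*} [Group G]
    [TopologicalSpace G] [IsTopologicalGroup G] [CompactSpace G] [T2Space G] (h : IsFreeProSigmaCyclic S G)
    {g : G} (hg : Dense (Subgroup.zpowers g : Set G)) : IsProSigmaCompletion S (zpowersHom G g) := by
  refine ⟨?_, fun N _ hN => ?_, fun N _ hN => ?_⟩
  · have hr : Set.range (zpowersHom G g) = (Subgroup.zpowers g : Set G) := by
      ext x
      simp only [Set.mem_range, zpowersHom_apply, SetLike.mem_coe, Subgroup.mem_zpowers_iff]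
      exact ⟨fun ⟨m, hm⟩ => ⟨m.toAdd, hm⟩, fun ⟨k, hk⟩ => ⟨Multiplicative.ofAdd k, hk⟩⟩
    rw [hr]; exact hg
  · haveI : Finite (G ⧸ N) := Subgroup.quotient_finite_of_isOpen N hN
    exact (h.isOpen_index_iff N.index).mp ⟨N, hN, rfl⟩
  · obtain ⟨U, hUo, hUi⟩ := (h.isOpen_index_iff N.index).mpr hN
    refine ⟨U, hUo, ?_⟩
    have hUeq := eq_closureZpowersPow_of_isOpen_of_index hg hUo hN.1 hUi
    ext m
    rw [Subgroup.mem_comap, zpowersHom_apply, hUeq, zpow_mem_closureZpowersPow_iff hg hN.1 (hUeq ▸ hUi),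
      ← Literature.IUT.HodgeTheaters.ZHat.ofAdd_mem_iff_index_dvd, ofAdd_toAdd]

namespace TwoTripodNodal.Model

open Literature.GroupTheory.CombinatorialGroupTheory
open Literature.GroupTheory.CombinatorialGroupTheory.PuncturedSurfaceGroup

variable {Sigma : Set ℕ} (M : Model Sigma)

/-! ### Graph homomorphisms out of a free pro-`Σ`-cyclic section -/

/-- **Graph homomorphisms.**  Let `B = closure ⟨b⟩ ⊆ P` be closed and free pro-`Σ`-cyclic, `K ⊆ Π_𝔾` closed and
`y ∈ K`.  Then there is a continuous homomorphism `θ : B → P` with values in `K` and `θ(b) = y` (continuous extension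
of `b^m ↦ y^m` along the pro-`Σ` completion `ℤ → B`, into the pro-`Σ` group `Π_𝔾`; `θ(B) ⊆ K` by density).
[cite: MochizukiSemiAnbd2006, Ex. 2.10 p.31] -/
theorem exists_graphHom {B : Subgroup M.P} (hBc : IsClosed (B : Set M.P)) (hBfree : IsFreeProSigmaCyclic Sigma ↥B)
    {b : M.P} (hBeq : B = (Subgroup.zpowers b).topologicalClosure) (hb : b ∈ B)
    {K : Subgroup ↥M.PiG} (hK : IsClosed (K : Set ↥M.PiG)) {y : ↥M.PiG} (hy : y ∈ K) :
    ∃ θ : ↥B →* M.P, Continuous θ ∧ (∀ s, θ s ∈ K.map M.PiG.subtype) ∧ θ ⟨b, hb⟩ = (y : M.P) := by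
  haveI : CompactSpace ↥B := isCompact_iff_compactSpace.mp hBc.isCompact
  haveI : CompactSpace ↥M.PiG := isCompact_iff_compactSpace.mp M.isClosed_PiG.isCompact
  have hκ : IsProSigmaCompletion Sigma (zpowersHom ↥B ⟨b, hb⟩) :=
    hBfree.isProSigmaCompletion_zpowersHom (M.dense_zpowers_of_eq_topologicalClosure hBeq hb)
  obtain ⟨ψ, hψc, hψκ⟩ := exists_continuous_extend_profinite hκ M.isProSigmaCompletion_κG.index_open
    (zpowersHom ↥M.PiG y)
  -- `ψ(B) ⊆ K` by density of `⟨b⟩` in `B`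
  have hψval : ∀ s, ψ s ∈ K := by
    have hcl : IsClosed ((K.comap ψ : Subgroup ↥B) : Set ↥B) := hK.preimage hψc
    have hsub : Set.range (zpowersHom ↥B ⟨b, hb⟩) ⊆ ((K.comap ψ : Subgroup ↥B) : Set ↥B) := by
      rintro _ ⟨m, rfl⟩
      rw [SetLike.mem_coe, Subgroup.mem_comap, hψκ, zpowersHom_apply]
      exact Subgroup.zpow_mem _ hy _
    intro s
    have hs : s ∈ closure (Set.range (zpowersHom ↥B ⟨b, hb⟩)) := hκ.dense.closure_eq ▸ Set.mem_univ s
    exact hcl.closure_subset_iff.mpr hsub hs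
  refine ⟨M.PiG.subtype.comp ψ, continuous_subtype_val.comp hψc, fun s => ⟨ψ s, hψval s, rfl⟩, ?_⟩
  have h1 : (⟨b, hb⟩ : ↥B) = zpowersHom ↥B ⟨b, hb⟩ (Multiplicative.ofAdd (1 : ℤ)) := by
    rw [zpowersHom_apply, toAdd_ofAdd, zpow_one]
  rw [MonoidHom.comp_apply, h1, hψκ, zpowersHom_apply, toAdd_ofAdd, zpow_one, Subgroup.coe_subtype]

/-- **`closure ⟨y · b⟩ ∩ Π_𝔾 = 1`** for `B = closure ⟨b⟩ ≅ Ẑ^Σ` meeting `Π_𝔾` trivially, `K ⊆ Π_𝔾` closed commuting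
with `B`, `y ∈ K`: the section `closure ⟨y·b⟩` lies in the graph `{θ(s)·s : s ∈ B}` of the graph homomorphism `θ`
(`θ(b) = y`), a compact subgroup meeting `Π_𝔾` trivially since `B` does (abc-iut-f-066 gen 7's slope-section argument,
over the index-`i` inertia section). [cite: MochizukiAbsTopII2013, Prop 1.3 (x) p.12] -/
theorem graphSection_inf_PiG {B : Subgroup M.P} (hBc : IsClosed (B : Set M.P)) (hBfree : IsFreeProSigmaCyclic Sigma ↥B)
    {b : M.P} (hBeq : B = (Subgroup.zpowers b).topologicalClosure) (hb : b ∈ B) (hBG : B ⊓ M.PiG = ⊥)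
    {K : Subgroup ↥M.PiG} (hK : IsClosed (K : Set ↥M.PiG))
    (hcomm : ∀ s ∈ B, ∀ x ∈ K.map M.PiG.subtype, x * s = s * x) {y : ↥M.PiG} (hy : y ∈ K) :
    (Subgroup.zpowers ((y : M.P) * b)).topologicalClosure ⊓ M.PiG = ⊥ := by
  obtain ⟨θ, hθc, hθK, hθb⟩ := M.exists_graphHom hBc hBfree hBeq hb hK hy
  have hKle : K.map M.PiG.subtype ≤ M.PiG := Subgroup.map_subtype_le _
  -- the graph homomorphism `s ↦ θ(s)·s`
  let g : ↥B →* M.P :=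
    { toFun := fun s => θ s * s
      map_one' := by rw [Subgroup.coe_one, map_one, one_mul]
      map_mul' := fun a c => by
        rw [Subgroup.coe_mul, map_mul, mul_assoc (θ a), ← mul_assoc (θ c), hcomm a a.2 (θ c) (hθK c), mul_assoc,
          mul_assoc] }
  have hgc : Continuous g := hθc.mul continuous_subtype_val
  haveI : CompactSpace ↥B := isCompact_iff_compactSpace.mp hBc.isCompact
  have hclosed : IsClosed ((g.range : Subgroup M.P) : Set M.P) := by
    rw [MonoidHom.coe_range]; exact (isCompact_range hgc).isClosed
  have hinf : g.range ⊓ M.PiG = ⊥ := by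
    rw [eq_bot_iff]
    rintro x ⟨⟨s, rfl⟩, hxA⟩
    have hsA : (s : M.P) ∈ M.PiG := by
      have h : θ s * (s : M.P) ∈ M.PiG := hxA
      exact (Subgroup.mul_mem_cancel_left M.PiG (hKle (hθK s))).mp h
    have hs1 : (s : M.P) = 1 := by
      have h : (s : M.P) ∈ B ⊓ M.PiG := ⟨s.2, hsA⟩
      rwa [hBG, Subgroup.mem_bot] at h
    rw [Subgroup.mem_bot]
    show θ s * s = 1
    have hs1' : s = 1 := Subtype.ext hs1
    rw [hs1', map_one, Subgroup.coe_one, one_mul]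
  have hle : (Subgroup.zpowers ((y : M.P) * b)).topologicalClosure ≤ g.range := by
    refine Subgroup.topologicalClosure_minimal _ ((Subgroup.zpowers_le).mpr ⟨⟨b, hb⟩, ?_⟩) hclosed
    show θ ⟨b, hb⟩ * b = (y : M.P) * b
    rw [hθb]
  rw [eq_bot_iff, ← hinf]
  exact inf_le_inf_right _ hle

/-- The carrier of `Π_𝔾 ⊔ B` is the product set and it is closed, for `B` closed (`Π_𝔾` closed normal).
[cite: MochizukiAbsTopII2013, Def 1.2 (ii) p.10] -/
theorem coe_PiG_sup_of_isClosed {B : Subgroup M.P} (hBc : IsClosed (B : Set M.P)) :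
    ((M.PiG ⊔ B : Subgroup M.P) : Set M.P) = (M.PiG : Set M.P) * (B : Set M.P) ∧
      IsClosed ((M.PiG ⊔ B : Subgroup M.P) : Set M.P) := by
  haveI := M.normal_PiG
  have h : ((M.PiG ⊔ B : Subgroup M.P) : Set M.P) = (M.PiG : Set M.P) * (B : Set M.P) := by rw [Subgroup.normal_mul]
  exact ⟨h, h ▸ (M.isClosed_PiG.isCompact.mul hBc.isCompact).isClosed⟩

/-- **`closure ⟨y · b⟩ ⊆ Π_𝔾 · B`** for `y ∈ Π_𝔾`, `B = closure ⟨b⟩` closed. [cite: MochizukiAbsTopII2013, Prop 1.3 (x) p.12] -/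
theorem graphSection_le {B : Subgroup M.P} (hBc : IsClosed (B : Set M.P)) {b : M.P} (hb : b ∈ B) {y : M.P}
    (hy : y ∈ M.PiG) : (Subgroup.zpowers (y * b)).topologicalClosure ≤ M.PiG ⊔ B :=
  Subgroup.topologicalClosure_minimal _ ((Subgroup.zpowers_le).mpr
    (Subgroup.mul_mem _ (Subgroup.mem_sup_left hy) (Subgroup.mem_sup_right hb))) (M.coe_PiG_sup_of_isClosed hBc).2

/-- **`closure ⟨y · b⟩ · Π_𝔾 = Π_𝔾 · B`** for `y ∈ Π_𝔾` and `B = closure ⟨b⟩` closed: the section surjects onto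
`I = (Π_𝔾·B)/Π_𝔾` (`b = y⁻¹ (y b)`; both sides closed). [cite: MochizukiAbsTopII2013, Prop 1.3 (x) p.12] -/
theorem graphSection_sup_PiG {B : Subgroup M.P} (hBc : IsClosed (B : Set M.P)) {b : M.P}
    (hBeq : B = (Subgroup.zpowers b).topologicalClosure) (hb : b ∈ B) {y : M.P} (hy : y ∈ M.PiG) :
    (Subgroup.zpowers (y * b)).topologicalClosure ⊔ M.PiG = M.PiG ⊔ B := by
  refine le_antisymm (sup_le (M.graphSection_le hBc hb hy) le_sup_left) (sup_le le_sup_right ?_)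
  rw [hBeq]
  refine Subgroup.topologicalClosure_minimal _ ((Subgroup.zpowers_le).mpr ?_) ?_
  · have hyb : y * b ∈ (Subgroup.zpowers (y * b)).topologicalClosure ⊔ M.PiG :=
      Subgroup.mem_sup_left (Subgroup.le_topologicalClosure _ (Subgroup.mem_zpowers _))
    have h := Subgroup.mul_mem _ (Subgroup.mem_sup_right (M.PiG.inv_mem hy)) hyb
    rwa [inv_mul_cancel_left] at h
  · rw [sup_comm]; exact (M.coe_PiG_sup_of_isClosed (Subgroup.isClosed_topologicalClosure _)).2

/-- A conjugate of a section of `Π_I^{(i)} ↠ I` is again contained in `Π_I^{(i)}` (normality).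
[cite: MochizukiAbsTopII2013, Def 1.2 (ii) p.10] -/
theorem conj_smul_le_PiIdx (i : ℕ) {S : Subgroup M.P} (hS : S ≤ M.PiIdx i) (δ : M.P) :
    MulAut.conj δ • S ≤ M.PiIdx i := by
  haveI := M.normal_PiIdx i
  calc MulAut.conj δ • S ≤ MulAut.conj δ • M.PiIdx i := Subgroup.pointwise_smul_le_pointwise_smul_iff.mpr hS
    _ = M.PiIdx i := Subgroup.Normal.conj_smul_eq_self δ (M.PiIdx i)

/-- Conjugating a supplement: if `S · Π_𝔾 = Π_I^{(i)}` then `(δSδ⁻¹) · Π_𝔾 = Π_I^{(i)}` (both `Π_𝔾` and `Π_I^{(i)}` are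
normal). [cite: MochizukiAbsTopII2013, Def 1.2 (ii) p.10] -/
theorem conj_smul_sup_PiG_eq_PiIdx (i : ℕ) {S : Subgroup M.P} (hS : S ⊔ M.PiG = M.PiIdx i) (δ : M.P) :
    MulAut.conj δ • S ⊔ M.PiG = M.PiIdx i := by
  haveI := M.normal_PiG
  haveI := M.normal_PiIdx i
  have h := congrArg (fun H : Subgroup M.P => MulAut.conj δ • H) hS
  simp only [Subgroup.smul_sup, Subgroup.Normal.conj_smul_eq_self] at h
  exact h

end TwoTripodNodal.Model

end Literature.AnabelianGeometry.AbsoluteAnabelian.AbsTopII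

end
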